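import Summits.AtomisticToContinuum.FouriersLaw.Theses.PhononMeanFreePath
import Summits.AtomisticToContinuum.FouriersLaw.Theorems.PhononMeanFreePathDefs
import Summits.AtomisticToContinuum.FouriersLaw.Theorems.PhononMeanFreePathCoherentDephasingWeakCouplingIntegrability
import Summits.AtomisticToContinuum.FouriersLaw.Theorems.PhononMeanFreePathCoherentDephasingResponseRegularity
import Summits.AtomisticToContinuum.FouriersLaw.Theorems.PhononMeanFreePathCoherentDephasingMeanFieldDuhamel
import Summits.AtomisticToContinuum.FouriersLaw.Theorems.PhononMeanFreePathCoherentDephasingHarmFluxBound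
import Summits.AtomisticToContinuum.FouriersLaw.Theorems.PhononMeanFreePathCoherentDephasingSiteBookkeeping
import Summits.AtomisticToContinuum.FouriersLaw.Theorems.PhononMeanFreePathCoherentDephasingTelescoping
import Summits.AtomisticToContinuum.FouriersLaw.Theorems.PhononMeanFreePathCoherentDephasingLossComposition
import Summits.AtomisticToContinuum.FouriersLaw.Theorems.PhononMeanFreePathCoherentDephasingOfLocalLossBound

/-!
# `CoherentDephasing` from a BULK block flux attenuation bound and a CONTACT bound (line `Sketch`, crux stmt-AtomisticToContinuum-11810)

Flux-form Beer–Lambert glue for line `Sketch` (coherent-field Beer–Lambert) of the crux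
`PhononMeanFreePath.CoherentDephasing`. For the `(N+1)`-site pinned anharmonic chain (Langevin baths at sites `0` and
`N`) write `Ĵ_b = harmFlux b` and `s_x = siteWork x` for the time-integrated symmetric harmonic fluxes and site works
of the Gibbs-averaged linear response to a momentum kick at site `0`, and `D_N = γ∫₀^∞ m_N²` for the far-bath
dissipation. Hypothesis (i) is the block FLUX ATTENUATION bound `κ Ĵ_{x-1} ≤ Σ_{i<L₀} s_{x+i}` with `0 < κ ≤ 1` for
every BULK block `x, …, x+L₀-1` (`1 ≤ x`, `L ≤ x`, `x + L₀ + K ≤ N`): the block extracts at least the fraction `κ` of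
the harmonic flux `Ĵ_{x-1}` entering it; hypothesis (ii) is the CONTACT bound `D_N ≤ (1+C) · max(Ĵ_{N-K-1}, 0)`.

Proof. Abstract core `dissipation_le_geometric_fluxAttenuation` (pure real arithmetic on `ℕ`-indexed families): tile
the bulk sites `a, …, M` (`M = N-K-1`) by `n` blocks of `L₀` sites; telescoping the site balances
`Ĵ_{x-1} - Ĵ_x = s_x` over block `j` gives `F_j - F_{j+1} = Σ_{block j} s ≥ κ F_j` for the block-boundary fluxes
`F_j = Ĵ_{a+jL₀-1}`, i.e. `F_{j+1} ≤ (1-κ) F_j`; since `0 ≤ 1-κ`, the positive parts contract,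
`max(F_{j+1},0) ≤ (1-κ) max(F_j,0)` (`max_le_geometric_of_step`), so `max(Ĵ_M,0) ≤ max(B,0)(1-κ)^n` with `Ĵ ≤ B`
the landed `N`-uniform flux bound, and `D_N ≤ (1+C) max(B,0) (1-κ)^n`. The reduction concludes
`N ∫₀^∞ m_N² → 0` by `N θ^{(N-c)/L₀} → 0` (`…Telescoping`), the fixed-`N` site balances coming from
`…SiteBookkeeping` (on `…MeanFieldDuhamel`, `…ResponseRegularity`) and the integrability clause from
`pairCorr_sq_integrableOn`.

Remark (why `κ ≤ 1`). Without a sign on the incoming flux the plain bound `κ Ĵ_in ≤ Σ_block s = Ĵ_in - Ĵ_out` with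
`κ > 1` only says `Ĵ_out ≤ -(κ-1) Ĵ_in`, which does not propagate smallness of positive parts: the profile
`Ĵ = (0, …, 0, -B/(κ-1), B)` on consecutive block boundaries satisfies every such bound, the balances and `Ĵ ≤ B`, with
`Ĵ_M = B` independent of the number of blocks. The variant with the POSITIVE PART of the incoming flux,
`κ max(Ĵ_{x-1},0) ≤ Σ_block s` (any `κ > 0`), implies the `κ ≤ 1` form with `min κ 1`
(`coherentDephasing_of_blockPosFluxAttenuation_of_contactBound`).
-/

noncomputable section

open MeasureTheory Set Filter Topology

namespace Summit.AtomisticToContinuum.FouriersLaw.Theorems.CoherentDephasing.FluxAttenuation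

open Literature.MathematicalPhysics.KineticTheory.HeatConduction (pinnedChain PhaseSpace)
open Summit.AtomisticToContinuum.FouriersLaw.Theses.PhononMeanFreePath (CoherentDephasing)
open Summit.AtomisticToContinuum.FouriersLaw.Theorems.PhononMeanFreePath
open Summit.AtomisticToContinuum.FouriersLaw.Theorems.CoherentDephasing.Telescoping (tendsto_natMul_pow_div)
open Summit.AtomisticToContinuum.FouriersLaw.Theorems.CoherentDephasing.MeanFieldDuhamel (stub_meanFieldDuhamel)
open Summit.AtomisticToContinuum.FouriersLaw.Theorems.CoherentDephasing.ResponseRegularity (stub_responseRegularity)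
open Summit.AtomisticToContinuum.FouriersLaw.Theorems.CoherentDephasing.SiteBookkeeping (stub_siteBookkeeping_of_meanField)
open Summit.AtomisticToContinuum.FouriersLaw.Theorems.CoherentDephasing.HarmFluxBound (stub_harmFluxBound)
open Summit.AtomisticToContinuum.FouriersLaw.Theorems.CoherentDephasing.OfLocalLossBound
  (sum_ite_succ_eq sum_ite_val_eq_of_lt sum_ite_val_eq_zero)

/-! ## Abstract part: one-step contraction of the positive parts of the block-boundary fluxes -/

/-- **Iterating a one-step contraction of positive parts.** If `max(F (j+1), 0) ≤ θ · max(F j, 0)` for `j < n`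
(`θ ≥ 0`) and `F 0 ≤ B`, then `max(F n, 0) ≤ max(B,0) · θ^n`. [folklore] -/
theorem max_le_geometric_of_step (F : ℕ → ℝ) (B θ : ℝ) (n : ℕ) (hθ : 0 ≤ θ)
    (hstep : ∀ j, j < n → max (F (j + 1)) 0 ≤ θ * max (F j) 0) (hhead : F 0 ≤ B) :
    max (F n) 0 ≤ max B 0 * θ ^ n := by
  have hiter : ∀ k, k ≤ n → max (F k) 0 ≤ θ ^ k * max (F 0) 0 := by
    intro k
    induction k with
    | zero => intro _; simp
    | succ k ih =>
      intro hk
      calc max (F (k + 1)) 0 ≤ θ * max (F k) 0 := hstep k (by omega)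
        _ ≤ θ * (θ ^ k * max (F 0) 0) := mul_le_mul_of_nonneg_left (ih (by omega)) hθ
        _ = θ ^ (k + 1) * max (F 0) 0 := by ring
  calc max (F n) 0 ≤ θ ^ n * max (F 0) 0 := hiter n le_rfl
    _ ≤ θ ^ n * max B 0 := mul_le_mul_of_nonneg_left (max_le_max hhead le_rfl) (pow_nonneg hθ _)
    _ = max B 0 * θ ^ n := mul_comm _ _

/-- **Geometric decay of the coherent flux from a BULK block flux attenuation bound and a contact bound** (abstract
core). `J, s : ℕ → ℝ` (flux through bond `b`, site work at site `x`); the bulk sites `a, …, M` (`a ≥ 1`) are tiled by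
`n` blocks of `L₀` sites, `a + n L₀ = M + 1`. Assume the site balances `J (x-1) - J x = s x` on `a ≤ x ≤ M`, the block
flux attenuation bound `κ J (a + jL₀ - 1) ≤ Σ_{block j} s` with `κ ≤ 1` on each of the `n` blocks, the head bound
`J (a-1) ≤ B` and the contact bound `D ≤ (1+C) max(J M, 0)` (`C ≥ 0`). Then `D ≤ (1+C) · max(B,0) · (1-κ)^n`.
[folklore] -/
theorem dissipation_le_geometric_fluxAttenuation (J s : ℕ → ℝ) (D B κ C : ℝ) (M a L₀ n : ℕ) (hκ1 : κ ≤ 1)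
    (hC : 0 ≤ C) (ha : 1 ≤ a) (htile : a + n * L₀ = M + 1)
    (hbal : ∀ x, a ≤ x → x ≤ M → J (x - 1) - J x = s x)
    (hatt : ∀ j, j < n → κ * J (a + j * L₀ - 1) ≤ ∑ i ∈ Finset.range L₀, s (a + j * L₀ + i))
    (hhead : J (a - 1) ≤ B) (hD : D ≤ (1 + C) * max (J M) 0) :
    D ≤ (1 + C) * max B 0 * (1 - κ) ^ n := by
  set θ : ℝ := 1 - κ with hθdef
  have hθ0 : 0 ≤ θ := by rw [hθdef]; linarith
  -- products `j * L₀`: the facts `omega` needs, stated on the atoms it sees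
  have hmulS : ∀ j : ℕ, (j + 1) * L₀ = j * L₀ + L₀ := fun j => Nat.succ_mul j L₀
  have hmuln : ∀ j : ℕ, j ≤ n → j * L₀ ≤ n * L₀ := fun j hj => Nat.mul_le_mul_right L₀ hj
  -- block balance by telescoping the site balances over block `j` (sites `a + jL₀, …, a + jL₀ + L₀ - 1`)
  have hblock : ∀ j, j < n →
      J (a + j * L₀ - 1) - J (a + (j + 1) * L₀ - 1) = ∑ i ∈ Finset.range L₀, s (a + j * L₀ + i) := by
    intro j hjn
    have hj1 := hmuln (j + 1) hjn
    rw [hmulS] at hj1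
    have htel : ∑ i ∈ Finset.range L₀, s (a + j * L₀ + i) =
        ∑ i ∈ Finset.range L₀, (J (a + j * L₀ - 1 + i) - J (a + j * L₀ - 1 + (i + 1))) := by
      refine Finset.sum_congr rfl fun i hi => ?_
      rw [Finset.mem_range] at hi
      rw [← hbal (a + j * L₀ + i) (by omega) (by omega),
        show a + j * L₀ + i - 1 = a + j * L₀ - 1 + i by omega,
        show a + j * L₀ - 1 + (i + 1) = a + j * L₀ + i by omega]
    rw [htel, Finset.sum_range_sub' (fun i => J (a + j * L₀ - 1 + i)) L₀]
    simp only [add_zero]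
    rw [hmulS, show a + (j * L₀ + L₀) - 1 = a + j * L₀ - 1 + L₀ by omega]
  -- one-step contraction of the positive parts of the boundary fluxes: `F (j+1) ≤ (1-κ) F j`, `0 ≤ 1-κ`
  have hstep : ∀ j, j < n → max (J (a + (j + 1) * L₀ - 1)) 0 ≤ θ * max (J (a + j * L₀ - 1)) 0 := by
    intro j hjn
    have h1 := hblock j hjn
    have h2 := hatt j hjn
    have h3 : J (a + (j + 1) * L₀ - 1) ≤ θ * J (a + j * L₀ - 1) := by rw [hθdef]; linarith
    exact max_le (h3.trans (mul_le_mul_of_nonneg_left (le_max_left _ _) hθ0))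
      (mul_nonneg hθ0 (le_max_right _ _))
  -- geometric decay of the positive parts down to the last bulk bond `M = a + nL₀ - 1`
  have hend : max (J M) 0 ≤ max B 0 * θ ^ n := by
    have h := max_le_geometric_of_step (fun j => J (a + j * L₀ - 1)) B θ n hθ0 (fun j hj => hstep j hj)
      (by simpa using hhead)
    have e : a + n * L₀ - 1 = M := by omega
    simpa only [e] using h
  calc D ≤ (1 + C) * max (J M) 0 := hD
    _ ≤ (1 + C) * (max B 0 * θ ^ n) := mul_le_mul_of_nonneg_left hend (by linarith)
    _ = (1 + C) * max B 0 * θ ^ n := by ring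

/-! ## The conditional reduction (bulk block flux attenuation + contact bound) -/

/-- **`CoherentDephasing` from a bulk block flux attenuation bound and a contact bound.** If for every admissible
parameter point there are a block length `L₀ ≥ 1`, a head margin `L`, a contact depth `K`, a threshold `N₀`, a rate
`0 < κ ≤ 1` and a constant `C ≥ 0` such that for every chain with `N ≥ N₀` (i) every BULK block of `L₀` consecutive
sites `x, …, x+L₀-1` with `1 ≤ x`, `L ≤ x` and `x + L₀ + K ≤ N` extracts through its site works at least `κ ×` the
harmonic flux `Ĵ_{x-1}` entering it, and (ii) the far-bath dissipation `γ∫₀^∞ m_N²` is at most `(1+C) ×` the positive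
part of the coherent flux `Ĵ_{N-K-1}` into the contact region, then the coherent channel closes (`CoherentDephasing`,
by name). [folklore] -/
theorem coherentDephasing_of_blockFluxAttenuation_of_contactBound :
    (∀ ω₂ lam β γ : ℝ, 0 < ω₂ → 0 < lam → 0 < β → 0 < γ → ∀ T : ℝ, 0 < T →
      ∃ L₀ L K N₀ : ℕ, ∃ κ C : ℝ, 0 < L₀ ∧ 0 < κ ∧ κ ≤ 1 ∧ 0 ≤ C ∧
        (∀ N : ℕ, N₀ ≤ N → ∀ (x : ℕ) (hx : x + L₀ + K ≤ N) (h1 : 1 ≤ x), L ≤ x →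
          κ * harmFlux ω₂ lam β γ T N ⟨x - 1, by omega⟩ ≤
            ∑ i : Fin L₀, siteWork ω₂ lam β γ T N ⟨x + i, by omega⟩) ∧
        (∀ (N : ℕ) (hN : K < N), N₀ ≤ N →
          γ * ∫ t in Set.Ioi (0 : ℝ), momResp ω₂ lam β γ T N (Fin.last N) t ^ 2 ≤
            (1 + C) * max (harmFlux ω₂ lam β γ T N ⟨N - K - 1, by omega⟩) 0)) →
    Summit.AtomisticToContinuum.FouriersLaw.Theses.PhononMeanFreePath.CoherentDephasing := by
  intro hH ω₂ lam β γ hω hl hβ hγ T hT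
  refine ⟨fun N => Summit.AtomisticToContinuum.FouriersLaw.Theorems.CoherentDephasing.pairCorr_sq_integrableOn
    hω hl.le hβ hγ hT N, ?_⟩
  obtain ⟨B, hBflux⟩ := stub_harmFluxBound ω₂ lam β γ hω hl hβ hγ T hT
  obtain ⟨L₀, L, K, N₀, κ, C, hL₀, hκ, hκ1, hC, hatt, hcontact⟩ := hH ω₂ lam β γ hω hl hβ hγ T hT
  have hbook := fun N => stub_siteBookkeeping_of_meanField ω₂ lam β γ hω hl hβ hγ T hT N
    (stub_meanFieldDuhamel ω₂ lam β γ hω hl hβ hγ T hT N) (stub_responseRegularity ω₂ lam β γ hω hl hβ hγ T hT N)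
  set D : ℕ → ℝ := fun N => γ * ∫ t in Ioi (0 : ℝ), momResp ω₂ lam β γ T N (Fin.last N) t ^ 2 with hD
  set θ : ℝ := 1 - κ with hθ
  have hθ0 : 0 ≤ θ := by rw [hθ]; linarith
  have hθ1 : θ < 1 := by rw [hθ]; linarith
  -- head margin `L' = max L 1` (bulk blocks avoid site `0` as well)
  set L' : ℕ := max L 1 with hL'
  have hL'L : L ≤ L' := le_max_left L 1
  have hL'1 : 1 ≤ L' := le_max_right L 1
  have hI0 : ∀ N : ℕ, 0 ≤ ∫ t in Ioi (0 : ℝ), momResp ω₂ lam β γ T N (Fin.last N) t ^ 2 := fun N =>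
    setIntegral_nonneg measurableSet_Ioi fun t _ => sq_nonneg _
  have hgeo : ∀ N : ℕ, N₀ ≤ N → K + L' ≤ N → D N ≤ (1 + C) * max B 0 * θ ^ ((N - K - L') / L₀) := by
    intro N hN0 hN
    obtain ⟨hbal, -⟩ := hbook N
    -- `n` blocks of `L₀` sites ending at the last bulk site `M = N - K - 1`, origin `a = N - K - nL₀ ≥ L'`
    set n : ℕ := (N - K - L') / L₀ with hn
    have hnL : n * L₀ ≤ N - K - L' := Nat.div_mul_le_self _ _
    -- `ℕ`-indexed flux `J` and site work `s`, junk `0` out of range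
    refine dissipation_le_geometric_fluxAttenuation
      (fun b => if h : b < N then harmFlux ω₂ lam β γ T N ⟨b, h⟩ else 0)
      (fun x => if h : x < N + 1 then siteWork ω₂ lam β γ T N ⟨x, h⟩ else 0)
      (D N) B κ C (N - K - 1) (N - K - n * L₀) L₀ n hκ1 hC (by omega) (by omega) ?_ ?_ ?_ ?_
    · -- site balances at the interior sites `a ≤ x ≤ M` (`1 ≤ x ≤ N - 1`: no bath terms)
      intro x hx1 hx2
      have h := hbal ⟨x, by omega⟩
      rw [sum_ite_succ_eq N _ (show ((⟨x, by omega⟩ : Fin (N + 1)) : ℕ) - 1 < N by simp only; omega)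
        (show ((⟨x, by omega⟩ : Fin (N + 1)) : ℕ) ≠ 0 by simp only; omega),
        sum_ite_val_eq_of_lt N _ (show ((⟨x, by omega⟩ : Fin (N + 1)) : ℕ) < N by simp only; omega)] at h
      simp only at h
      rw [if_neg (by omega), if_neg (by omega), if_neg (by omega)] at h
      rw [dif_pos (show x - 1 < N by omega), dif_pos (show x < N by omega), dif_pos (show x < N + 1 by omega)]
      simp only [add_zero, mul_zero, zero_mul] at h
      linarith
    · -- the bulk block flux attenuation bound (hypothesis (i)) at block start `x = a + jL₀`, as a `range`-sum
      intro j hjn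
      have hj1 : (j + 1) * L₀ ≤ n * L₀ := Nat.mul_le_mul_right L₀ hjn
      rw [Nat.succ_mul] at hj1
      have h := hatt N hN0 (N - K - n * L₀ + j * L₀) (by omega) (by omega) (by omega)
      have e2 : ∑ i : Fin L₀, siteWork ω₂ lam β γ T N ⟨N - K - n * L₀ + j * L₀ + i, by omega⟩ =
          ∑ i : Fin L₀, (fun y => if h : y < N + 1 then siteWork ω₂ lam β γ T N ⟨y, h⟩ else 0)
            (N - K - n * L₀ + j * L₀ + i) := by
        refine Finset.sum_congr rfl fun i _ => ?_
        simp only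
        rw [dif_pos (show N - K - n * L₀ + j * L₀ + (i : ℕ) < N + 1 by omega)]
      rw [e2] at h
      rw [Finset.sum_range, dif_pos (show N - K - n * L₀ + j * L₀ - 1 < N by omega)]
      exact h
    · -- head: the `N`-uniform flux bound at bond `a - 1`
      rw [dif_pos (show N - K - n * L₀ - 1 < N by omega)]
      exact hBflux N _
    · -- contact bound (hypothesis (ii)) at the last bulk bond `M = N - K - 1`
      rw [dif_pos (show N - K - 1 < N by omega)]
      exact hcontact N (by omega) hN0
  -- the exponent `(N - K - L')/L₀ = (N - (K + L'))/L₀`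
  have hexp : ∀ N : ℕ, (N - K - L') / L₀ = (N - (K + L')) / L₀ := fun N => by rw [Nat.sub_sub]
  -- squeeze `0 ≤ N ∫ m_N² ≤ (N/γ)(1+C) max(B,0) θ^{…} → 0`
  have hlim := (tendsto_natMul_pow_div θ hθ0 hθ1 L₀ hL₀ (K + L')).const_mul ((1 + C) * max B 0 / γ)
  rw [mul_zero] at hlim
  change Tendsto (fun N : ℕ => (N : ℝ) * ∫ t in Ioi (0 : ℝ), momResp ω₂ lam β γ T N (Fin.last N) t ^ 2) atTop (𝓝 0)
  refine squeeze_zero' (Eventually.of_forall fun N => mul_nonneg (Nat.cast_nonneg N) (hI0 N)) ?_ hlim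
  filter_upwards [eventually_ge_atTop (max N₀ (K + L'))] with N hN
  have hN0 : N₀ ≤ N := le_of_max_le_left hN
  have hN1 : K + L' ≤ N := le_of_max_le_right hN
  have h1 : (N : ℝ) * ∫ t in Ioi (0 : ℝ), momResp ω₂ lam β γ T N (Fin.last N) t ^ 2 = (N : ℝ) * (D N / γ) := by
    simp only [hD]; field_simp
  rw [h1]
  have h2 : D N / γ ≤ (1 + C) * max B 0 / γ * θ ^ ((N - (K + L')) / L₀) := by
    have := div_le_div_of_nonneg_right (hgeo N hN0 hN1) hγ.le
    rw [hexp N] at this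
    calc D N / γ ≤ (1 + C) * max B 0 * θ ^ ((N - (K + L')) / L₀) / γ := this
      _ = (1 + C) * max B 0 / γ * θ ^ ((N - (K + L')) / L₀) := by ring
  calc (N : ℝ) * (D N / γ) ≤ (N : ℝ) * ((1 + C) * max B 0 / γ * θ ^ ((N - (K + L')) / L₀)) :=
      mul_le_mul_of_nonneg_left h2 (Nat.cast_nonneg N)
    _ = (1 + C) * max B 0 / γ * ((N : ℝ) * θ ^ ((N - (K + L')) / L₀)) := by ring

/-- **`CoherentDephasing` from a bulk block attenuation bound on the POSITIVE PART of the incoming flux and a contact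
bound.** The variant of `coherentDephasing_of_blockFluxAttenuation_of_contactBound` in which hypothesis (i) reads
`κ · max(Ĵ_{x-1}, 0) ≤ Σ_{i<L₀} s_{x+i}` with an arbitrary rate `κ > 0` (attenuation of a non-negative incoming flux,
and block passivity `Σ_block s ≥ 0` when the incoming flux is negative); it implies the plain form with the rate
`min κ 1 ≤ 1`. [folklore] -/
theorem coherentDephasing_of_blockPosFluxAttenuation_of_contactBound :
    (∀ ω₂ lam β γ : ℝ, 0 < ω₂ → 0 < lam → 0 < β → 0 < γ → ∀ T : ℝ, 0 < T →
      ∃ L₀ L K N₀ : ℕ, ∃ κ C : ℝ, 0 < L₀ ∧ 0 < κ ∧ 0 ≤ C ∧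
        (∀ N : ℕ, N₀ ≤ N → ∀ (x : ℕ) (hx : x + L₀ + K ≤ N) (h1 : 1 ≤ x), L ≤ x →
          κ * max (harmFlux ω₂ lam β γ T N ⟨x - 1, by omega⟩) 0 ≤
            ∑ i : Fin L₀, siteWork ω₂ lam β γ T N ⟨x + i, by omega⟩) ∧
        (∀ (N : ℕ) (hN : K < N), N₀ ≤ N →
          γ * ∫ t in Set.Ioi (0 : ℝ), momResp ω₂ lam β γ T N (Fin.last N) t ^ 2 ≤
            (1 + C) * max (harmFlux ω₂ lam β γ T N ⟨N - K - 1, by omega⟩) 0)) →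
    Summit.AtomisticToContinuum.FouriersLaw.Theses.PhononMeanFreePath.CoherentDephasing := by
  intro hH
  refine coherentDephasing_of_blockFluxAttenuation_of_contactBound fun ω₂ lam β γ hω hl hβ hγ T hT => ?_
  obtain ⟨L₀, L, K, N₀, κ, C, hL₀, hκ, hC, hatt, hcontact⟩ := hH ω₂ lam β γ hω hl hβ hγ T hT
  refine ⟨L₀, L, K, N₀, min κ 1, C, hL₀, lt_min hκ one_pos, min_le_right κ 1, hC, ?_, hcontact⟩
  intro N hN0 x hx h1 hLx
  refine le_trans ?_ (hatt N hN0 x hx h1 hLx)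
  -- `min κ 1 · Ĵ ≤ κ · max(Ĵ, 0)` by the sign of `Ĵ`
  rcases le_or_gt 0 (harmFlux ω₂ lam β γ T N ⟨x - 1, by omega⟩) with hJ | hJ
  · rw [max_eq_left hJ]
    exact mul_le_mul_of_nonneg_right (min_le_left κ 1) hJ
  · rw [max_eq_right hJ.le, mul_zero]
    exact mul_nonpos_iff.2 (Or.inl ⟨(lt_min hκ one_pos).le, hJ.le⟩)

end Summit.AtomisticToContinuum.FouriersLaw.Theorems.CoherentDephasing.FluxAttenuation

end
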